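import Summits.CriticalPhenomena.PercolationContinuityZ3.Theorems.PercNearOneGluingNoHeavyPcintBondCertZ3K6Defs
import HarnessLib

/-!
# PCINT lane, kernel check 5/8 of the B3r window certificate (`d = 3`, memory 6, `p = 0.2176`): codes `3888 ≤ n < 4860`

Cell `prim-pcint`, seat `prim-pcint-2`. The Collatz–Wielandt rows `10^5 · rowB ≤ 99995 · 2·10^72 · v` for the windows with
base-6 code in `[3888, 4860)`, by `decide +kernel` (natural-number arithmetic only; four chunks of 243 codes — larger
chunks exceed the kernel's recursion budget for these rows — hence `maxHeartbeats 0`). Does NOT build on p205010.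
-/

namespace Summit.CriticalPhenomena.PercolationContinuityZ3.Theorems.Pcint.Z3B6

set_option maxHeartbeats 0 in
/-- Rows `3888 ≤ n < 4131` of the certificate hold. [folklore] -/
theorem checkRangeB_5a : checkRangeB 3888 4131 = true := by decide +kernel

set_option maxHeartbeats 0 in
/-- Rows `4131 ≤ n < 4374` of the certificate hold. [folklore] -/
theorem checkRangeB_5b : checkRangeB 4131 4374 = true := by decide +kernel

set_option maxHeartbeats 0 in
/-- Rows `4374 ≤ n < 4617` of the certificate hold. [folklore] -/
theorem checkRangeB_5c : checkRangeB 4374 4617 = true := by decide +kernel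

set_option maxHeartbeats 0 in
/-- Rows `4617 ≤ n < 4860` of the certificate hold. [folklore] -/
theorem checkRangeB_5d : checkRangeB 4617 4860 = true := by decide +kernel

/-- Rows `3888 ≤ n < 4860` of the certificate hold. [folklore] -/
theorem checkRangeB_5 : checkRangeB 3888 4860 = true :=
  checkRangeB_of_split (checkRangeB_of_split checkRangeB_5a checkRangeB_5b) (checkRangeB_of_split checkRangeB_5c checkRangeB_5d)

end Summit.CriticalPhenomena.PercolationContinuityZ3.Theorems.Pcint.Z3B6
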